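import Summits.ValiantsHypothesis.ValiantsHypothesis.Theorems.LacunarySymmetroidMatrixDescartesDoorA26WallBubblingTwoScaleTripleMid
import Summits.ValiantsHypothesis.ValiantsHypothesis.Theorems.LacunarySymmetroidMatrixDescartesDoorA26WallBubblingTwoPairTripleTop

/-!
# Wall bubbling for `DoorA26` — TWO WEYL PAIRS, rung 4: THE MIDDLE RULE FOR THE PURE CLASSES `2δ₀`, `2δ₁` across two scales

HONEST FRAMING.  Chain lemma for obligation (W) `stub_weylFaces` of `Cruxes/DoorA26/Lines/wall_bubbling.lean` (stmt-ValiantsHypothesis-19979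
`DoorA26`; OPEN, typed, never asserted), W1 seat val-sym-door-p2 g13 (#49) — step 5 of the two-dslope port plan
`HOME/val-sym-door-p2/g13/TWO-DSLOPE-CHAIN-PORT.md` (rung 4 of 5).  W2's `twoScale_triple_mid` (door-p1 g15) VERBATIM for the two-dslope frames
(W1 #25/#45/#46): the confluent `t`-slot of a pure class alive at the first cluster kills the `t²`-slot at the second:

* **`twoPair_triple_mid₀₅`** — `Γ 0 5 ≠ 0 → Γ' 5 5 = 0`;  **`twoPair_triple_mid₁₄`** — `Γ 1 4 ≠ 0 → Γ' 4 4 = 0`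
  (hypotheses = those of `twoPair_twoScale_monotone`); scalar core = W2's `triple_mid_core` unchanged; stage identities W2's `triple_frameShift` /
  W1 #48 `triple_frameShift₁₄`.

No new definitions; nothing here bears on `DoorA26`, `MatrixDescartes` (stmt-ValiantsHypothesis-18050) or `VP ≠ VNP`; the two-pair chains stay OPEN.
`--supports stmt-ValiantsHypothesis-19979 --as helper`.  [this work = W2's rung 4, re-framed].
-/

-- `Summit.ValiantsHypothesis.ValiantsHypothesis.…` repeats a component by the D-0017 layout
-- (single-conjunct summit), which the `dupNamespace` linter flags; the name is mandated.
set_option linter.dupNamespace false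

namespace Summit.ValiantsHypothesis.ValiantsHypothesis.Theorems.LacunarySymmetroidMatrixDescartes.WallBubbling

open Finset Filter Topology
open Bubbling (polar polar_apply polar_comm polar_smul_left_right)
open scoped BigOperators

/-- **THE CLASS `2δ₀`, MIDDLE RULE (two scales, two Weyl pairs).**  If the `t`-slot `(0,5)` is alive in the first Gram-normalised limit, the
`t²`-slot `(5,5)` is dead in the second. [this work = W2's rung 4, re-framed] -/
theorem twoPair_triple_mid₀₅ (δs : ℕ → Fin 6 → ℝ) (δ0 : Fin 6 → ℝ)
    (hδ : ∀ l, Tendsto (fun ν => δs ν l) atTop (𝓝 (δ0 l))) (h50 : δ0 5 = δ0 0)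
    (U : ℕ → Fin 6 → Matrix (Fin 2) (Fin 2) ℝ) (L : ℕ → ℝ) (hL : Tendsto L atTop atTop)
    (μ μ' : ℕ → ℝ) (hμ : ∀ ν, 0 < μ ν) (hμ' : ∀ ν, 0 < μ' ν)
    (hdom : ∀ ν a b, |polar (if a = 0 then U ν 0 + U ν 5 else if a = 1 then U ν 1 + U ν 4
        else if a = 4 then (δs ν 4 - δs ν 1) • U ν 4 else if a = 5 then (δs ν 5 - δs ν 0) • U ν 5 else U ν a)
      (if b = 0 then U ν 0 + U ν 5 else if b = 1 then U ν 1 + U ν 4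
        else if b = 4 then (δs ν 4 - δs ν 1) • U ν 4 else if b = 5 then (δs ν 5 - δs ν 0) • U ν 5 else U ν b)| ≤ μ ν)
    (hdom' : ∀ ν a b, |polar
      (if a = 0 then Real.exp (δs ν 0 * L ν) • U ν 0 + Real.exp (δs ν 5 * L ν) • U ν 5
        else if a = 1 then Real.exp (δs ν 1 * L ν) • U ν 1 + Real.exp (δs ν 4 * L ν) • U ν 4
        else if a = 4 then (δs ν 4 - δs ν 1) • (Real.exp (δs ν 4 * L ν) • U ν 4)
        else if a = 5 then (δs ν 5 - δs ν 0) • (Real.exp (δs ν 5 * L ν) • U ν 5) else Real.exp (δs ν a * L ν) • U ν a)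
      (if b = 0 then Real.exp (δs ν 0 * L ν) • U ν 0 + Real.exp (δs ν 5 * L ν) • U ν 5
        else if b = 1 then Real.exp (δs ν 1 * L ν) • U ν 1 + Real.exp (δs ν 4 * L ν) • U ν 4
        else if b = 4 then (δs ν 4 - δs ν 1) • (Real.exp (δs ν 4 * L ν) • U ν 4)
        else if b = 5 then (δs ν 5 - δs ν 0) • (Real.exp (δs ν 5 * L ν) • U ν 5) else Real.exp (δs ν b * L ν) • U ν b)| ≤ μ' ν)
    (Γ Γ' : Fin 6 → Fin 6 → ℝ)
    (hΓ : ∀ a b, Tendsto (fun ν => polar (if a = 0 then U ν 0 + U ν 5 else if a = 1 then U ν 1 + U ν 4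
        else if a = 4 then (δs ν 4 - δs ν 1) • U ν 4 else if a = 5 then (δs ν 5 - δs ν 0) • U ν 5 else U ν a)
      (if b = 0 then U ν 0 + U ν 5 else if b = 1 then U ν 1 + U ν 4
        else if b = 4 then (δs ν 4 - δs ν 1) • U ν 4 else if b = 5 then (δs ν 5 - δs ν 0) • U ν 5 else U ν b) / μ ν) atTop (𝓝 (Γ a b)))
    (hΓ' : ∀ a b, Tendsto (fun ν => polar
      (if a = 0 then Real.exp (δs ν 0 * L ν) • U ν 0 + Real.exp (δs ν 5 * L ν) • U ν 5
        else if a = 1 then Real.exp (δs ν 1 * L ν) • U ν 1 + Real.exp (δs ν 4 * L ν) • U ν 4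
        else if a = 4 then (δs ν 4 - δs ν 1) • (Real.exp (δs ν 4 * L ν) • U ν 4)
        else if a = 5 then (δs ν 5 - δs ν 0) • (Real.exp (δs ν 5 * L ν) • U ν 5) else Real.exp (δs ν a * L ν) • U ν a)
      (if b = 0 then Real.exp (δs ν 0 * L ν) • U ν 0 + Real.exp (δs ν 5 * L ν) • U ν 5
        else if b = 1 then Real.exp (δs ν 1 * L ν) • U ν 1 + Real.exp (δs ν 4 * L ν) • U ν 4
        else if b = 4 then (δs ν 4 - δs ν 1) • (Real.exp (δs ν 4 * L ν) • U ν 4)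
        else if b = 5 then (δs ν 5 - δs ν 0) • (Real.exp (δs ν 5 * L ν) • U ν 5) else Real.exp (δs ν b * L ν) • U ν b) / μ' ν)
      atTop (𝓝 (Γ' a b)))
    (h1 : Γ 0 5 ≠ 0) : Γ' 5 5 = 0 := by
  by_contra h2
  set κ : ℝ := |Γ 0 5| / 2 with hκ
  set κ' : ℝ := |Γ' 5 5| / 2 with hκ'
  have hκpos : 0 < κ := by rw [hκ]; exact half_pos (abs_pos.mpr h1)
  have hκ'pos : 0 < κ' := by rw [hκ']; exact half_pos (abs_pos.mpr h2)
  have f50 : ((5 : Fin 6) = 0) = False := by simp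
  have f51 : ((5 : Fin 6) = 1) = False := by simp
  have f54 : ((5 : Fin 6) = 4) = False := by simp
  have f01 : ((0 : Fin 6) = 1) = False := by simp
  have f04 : ((0 : Fin 6) = 4) = False := by simp
  have f05 : ((0 : Fin 6) = 5) = False := by simp
  have hw0 : Tendsto (fun ν => δs ν 5 - δs ν 0) atTop (𝓝 0) := by
    have := (hδ 5).sub (hδ 0)
    rw [h50, sub_self] at this
    exact this
  have e1 : ∀ᶠ ν in atTop, κ * μ ν ≤ |polar (U ν 0 + U ν 5) ((δs ν 5 - δs ν 0) • U ν 5)| := by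
    have h := ((hΓ 0 5).abs).eventually_const_lt (show κ < |Γ 0 5| by rw [hκ]; linarith [abs_pos.mpr h1])
    filter_upwards [h] with ν hν
    simp only [f50, f51, f54, f01, f04, f05, if_false, if_true] at hν
    rw [abs_div, abs_of_pos (hμ ν), lt_div_iff₀ (hμ ν)] at hν
    exact hν.le
  have e2 : ∀ᶠ ν in atTop, κ' * μ' ν
      ≤ |polar ((δs ν 5 - δs ν 0) • (Real.exp (δs ν 5 * L ν) • U ν 5)) ((δs ν 5 - δs ν 0) • (Real.exp (δs ν 5 * L ν) • U ν 5))| := by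
    have h := ((hΓ' 5 5).abs).eventually_const_lt (show κ' < |Γ' 5 5| by rw [hκ']; linarith [abs_pos.mpr h2])
    filter_upwards [h] with ν hν
    simp only [f50, f51, f54, if_false, if_true] at hν
    rw [abs_div, abs_of_pos (hμ' ν), lt_div_iff₀ (hμ' ν)] at hν
    exact hν.le
  have eb : ∀ᶠ ν in atTop, 0 * Real.exp ((δs ν 5 - δs ν 0) * L ν) + 4 / κ
      < |dslope (fun y : ℝ => Real.exp (y * L ν)) 0 (δs ν 5 - δs ν 0)| :=
    eventually_dslope_exp_gt (fun ν => δs ν 5 - δs ν 0) L hw0 hL 0 (4 / κ) le_rfl (by positivity)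
  have ea : ∀ᶠ ν in atTop, (1 + 12 / κ') * Real.exp ((δs ν 5 - δs ν 0) * L ν) + 0
      < |dslope (fun y : ℝ => Real.exp (y * L ν)) 0 (δs ν 5 - δs ν 0)| :=
    eventually_dslope_exp_gt (fun ν => δs ν 5 - δs ν 0) L hw0 hL (1 + 12 / κ') 0 (by positivity) le_rfl
  have hfalse : ∀ᶠ ν : ℕ in atTop, False := by
    filter_upwards [e1, e2, eb, ea] with ν hν1 hν2 hνb hνa
    obtain ⟨i55, i05, i00⟩ := triple_frameShift (δs ν) (U ν) (L ν)
    set g55 := polar ((δs ν 5 - δs ν 0) • U ν 5) ((δs ν 5 - δs ν 0) • U ν 5) with hg55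
    set g05 := polar (U ν 0 + U ν 5) ((δs ν 5 - δs ν 0) • U ν 5) with hg05
    set g00 := polar (U ν 0 + U ν 5) (U ν 0 + U ν 5) with hg00
    set Λ := dslope (fun y : ℝ => Real.exp (y * L ν)) 0 (δs ν 5 - δs ν 0) with hΛ
    set E₀ := Real.exp (δs ν 0 * L ν) with hE₀
    set e := Real.exp ((δs ν 5 - δs ν 0) * L ν) with he
    have hE₀pos : 0 < E₀ := Real.exp_pos _
    have hepos : 0 < e := Real.exp_pos _
    have h00le : |g00| ≤ μ ν := by have := hdom ν 0 0; simp only [f01, f04, f05, if_false, if_true] at this; exact this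
    have hdom00 : E₀ * E₀ * |g00 + 2 * Λ * g05 + Λ * Λ * g55| ≤ μ' ν := by
      have := hdom' ν 0 0
      simp only [f01, f04, f05, if_false, if_true] at this
      rw [i00, abs_mul, abs_of_pos (mul_pos hE₀pos hE₀pos)] at this
      exact this
    have hdom05 : E₀ * E₀ * e * |g05 + Λ * g55| ≤ μ' ν := by
      have := hdom' ν 0 5
      simp only [f50, f51, f54, f01, f04, f05, if_false, if_true] at this
      rw [i05, abs_mul, abs_of_pos (by positivity)] at this
      exact this
    have halive : κ' * μ' ν ≤ E₀ * E₀ * (e * e) * |g55| := by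
      rw [i55, abs_mul, abs_of_pos (by positivity)] at hν2
      exact hν2
    have hΛge : 4 / κ ≤ |Λ| := by rw [zero_mul, zero_add] at hνb; exact hνb.le
    have hcore := triple_mid_core hκpos hκ'pos (hμ ν) hepos hE₀pos hν1 h00le hdom00 hdom05 halive hΛge
    rw [add_zero] at hνa
    exact absurd (lt_of_le_of_lt hcore hνa) (lt_irrefl _)
  exact hfalse.exists.elim fun _ h => h

/-- **THE CLASS `2δ₁`, MIDDLE RULE** — mirror statement for the pair `(1,4)`: `Γ 1 4 ≠ 0 → Γ' 4 4 = 0`. [this work] -/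
theorem twoPair_triple_mid₁₄ (δs : ℕ → Fin 6 → ℝ) (δ0 : Fin 6 → ℝ)
    (hδ : ∀ l, Tendsto (fun ν => δs ν l) atTop (𝓝 (δ0 l))) (h41 : δ0 4 = δ0 1)
    (U : ℕ → Fin 6 → Matrix (Fin 2) (Fin 2) ℝ) (L : ℕ → ℝ) (hL : Tendsto L atTop atTop)
    (μ μ' : ℕ → ℝ) (hμ : ∀ ν, 0 < μ ν) (hμ' : ∀ ν, 0 < μ' ν)
    (hdom : ∀ ν a b, |polar (if a = 0 then U ν 0 + U ν 5 else if a = 1 then U ν 1 + U ν 4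
        else if a = 4 then (δs ν 4 - δs ν 1) • U ν 4 else if a = 5 then (δs ν 5 - δs ν 0) • U ν 5 else U ν a)
      (if b = 0 then U ν 0 + U ν 5 else if b = 1 then U ν 1 + U ν 4
        else if b = 4 then (δs ν 4 - δs ν 1) • U ν 4 else if b = 5 then (δs ν 5 - δs ν 0) • U ν 5 else U ν b)| ≤ μ ν)
    (hdom' : ∀ ν a b, |polar
      (if a = 0 then Real.exp (δs ν 0 * L ν) • U ν 0 + Real.exp (δs ν 5 * L ν) • U ν 5
        else if a = 1 then Real.exp (δs ν 1 * L ν) • U ν 1 + Real.exp (δs ν 4 * L ν) • U ν 4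
        else if a = 4 then (δs ν 4 - δs ν 1) • (Real.exp (δs ν 4 * L ν) • U ν 4)
        else if a = 5 then (δs ν 5 - δs ν 0) • (Real.exp (δs ν 5 * L ν) • U ν 5) else Real.exp (δs ν a * L ν) • U ν a)
      (if b = 0 then Real.exp (δs ν 0 * L ν) • U ν 0 + Real.exp (δs ν 5 * L ν) • U ν 5
        else if b = 1 then Real.exp (δs ν 1 * L ν) • U ν 1 + Real.exp (δs ν 4 * L ν) • U ν 4
        else if b = 4 then (δs ν 4 - δs ν 1) • (Real.exp (δs ν 4 * L ν) • U ν 4)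
        else if b = 5 then (δs ν 5 - δs ν 0) • (Real.exp (δs ν 5 * L ν) • U ν 5) else Real.exp (δs ν b * L ν) • U ν b)| ≤ μ' ν)
    (Γ Γ' : Fin 6 → Fin 6 → ℝ)
    (hΓ : ∀ a b, Tendsto (fun ν => polar (if a = 0 then U ν 0 + U ν 5 else if a = 1 then U ν 1 + U ν 4
        else if a = 4 then (δs ν 4 - δs ν 1) • U ν 4 else if a = 5 then (δs ν 5 - δs ν 0) • U ν 5 else U ν a)
      (if b = 0 then U ν 0 + U ν 5 else if b = 1 then U ν 1 + U ν 4
        else if b = 4 then (δs ν 4 - δs ν 1) • U ν 4 else if b = 5 then (δs ν 5 - δs ν 0) • U ν 5 else U ν b) / μ ν) atTop (𝓝 (Γ a b)))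
    (hΓ' : ∀ a b, Tendsto (fun ν => polar
      (if a = 0 then Real.exp (δs ν 0 * L ν) • U ν 0 + Real.exp (δs ν 5 * L ν) • U ν 5
        else if a = 1 then Real.exp (δs ν 1 * L ν) • U ν 1 + Real.exp (δs ν 4 * L ν) • U ν 4
        else if a = 4 then (δs ν 4 - δs ν 1) • (Real.exp (δs ν 4 * L ν) • U ν 4)
        else if a = 5 then (δs ν 5 - δs ν 0) • (Real.exp (δs ν 5 * L ν) • U ν 5) else Real.exp (δs ν a * L ν) • U ν a)
      (if b = 0 then Real.exp (δs ν 0 * L ν) • U ν 0 + Real.exp (δs ν 5 * L ν) • U ν 5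
        else if b = 1 then Real.exp (δs ν 1 * L ν) • U ν 1 + Real.exp (δs ν 4 * L ν) • U ν 4
        else if b = 4 then (δs ν 4 - δs ν 1) • (Real.exp (δs ν 4 * L ν) • U ν 4)
        else if b = 5 then (δs ν 5 - δs ν 0) • (Real.exp (δs ν 5 * L ν) • U ν 5) else Real.exp (δs ν b * L ν) • U ν b) / μ' ν)
      atTop (𝓝 (Γ' a b)))
    (h1 : Γ 1 4 ≠ 0) : Γ' 4 4 = 0 := by
  by_contra h2
  set κ : ℝ := |Γ 1 4| / 2 with hκ
  set κ' : ℝ := |Γ' 4 4| / 2 with hκ'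
  have hκpos : 0 < κ := by rw [hκ]; exact half_pos (abs_pos.mpr h1)
  have hκ'pos : 0 < κ' := by rw [hκ']; exact half_pos (abs_pos.mpr h2)
  have f40 : ((4 : Fin 6) = 0) = False := by simp
  have f41 : ((4 : Fin 6) = 1) = False := by simp
  have f45 : ((4 : Fin 6) = 5) = False := by simp
  have f10 : ((1 : Fin 6) = 0) = False := by simp
  have f14 : ((1 : Fin 6) = 4) = False := by simp
  have f15 : ((1 : Fin 6) = 5) = False := by simp
  have hw0 : Tendsto (fun ν => δs ν 4 - δs ν 1) atTop (𝓝 0) := by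
    have := (hδ 4).sub (hδ 1)
    rw [h41, sub_self] at this
    exact this
  have e1 : ∀ᶠ ν in atTop, κ * μ ν ≤ |polar (U ν 1 + U ν 4) ((δs ν 4 - δs ν 1) • U ν 4)| := by
    have h := ((hΓ 1 4).abs).eventually_const_lt (show κ < |Γ 1 4| by rw [hκ]; linarith [abs_pos.mpr h1])
    filter_upwards [h] with ν hν
    simp only [f40, f41, f45, f10, f14, f15, if_false, if_true] at hν
    rw [abs_div, abs_of_pos (hμ ν), lt_div_iff₀ (hμ ν)] at hν
    exact hν.le
  have e2 : ∀ᶠ ν in atTop, κ' * μ' ν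
      ≤ |polar ((δs ν 4 - δs ν 1) • (Real.exp (δs ν 4 * L ν) • U ν 4)) ((δs ν 4 - δs ν 1) • (Real.exp (δs ν 4 * L ν) • U ν 4))| := by
    have h := ((hΓ' 4 4).abs).eventually_const_lt (show κ' < |Γ' 4 4| by rw [hκ']; linarith [abs_pos.mpr h2])
    filter_upwards [h] with ν hν
    simp only [f40, f41, f45, if_false, if_true] at hν
    rw [abs_div, abs_of_pos (hμ' ν), lt_div_iff₀ (hμ' ν)] at hν
    exact hν.le
  have eb : ∀ᶠ ν in atTop, 0 * Real.exp ((δs ν 4 - δs ν 1) * L ν) + 4 / κ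
      < |dslope (fun y : ℝ => Real.exp (y * L ν)) 0 (δs ν 4 - δs ν 1)| :=
    eventually_dslope_exp_gt (fun ν => δs ν 4 - δs ν 1) L hw0 hL 0 (4 / κ) le_rfl (by positivity)
  have ea : ∀ᶠ ν in atTop, (1 + 12 / κ') * Real.exp ((δs ν 4 - δs ν 1) * L ν) + 0
      < |dslope (fun y : ℝ => Real.exp (y * L ν)) 0 (δs ν 4 - δs ν 1)| :=
    eventually_dslope_exp_gt (fun ν => δs ν 4 - δs ν 1) L hw0 hL (1 + 12 / κ') 0 (by positivity) le_rfl
  have hfalse : ∀ᶠ ν : ℕ in atTop, False := by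
    filter_upwards [e1, e2, eb, ea] with ν hν1 hν2 hνb hνa
    obtain ⟨i55, i05, i00⟩ := triple_frameShift₁₄ (δs ν) (U ν) (L ν)
    set g55 := polar ((δs ν 4 - δs ν 1) • U ν 4) ((δs ν 4 - δs ν 1) • U ν 4) with hg55
    set g05 := polar (U ν 1 + U ν 4) ((δs ν 4 - δs ν 1) • U ν 4) with hg05
    set g00 := polar (U ν 1 + U ν 4) (U ν 1 + U ν 4) with hg00
    set Λ := dslope (fun y : ℝ => Real.exp (y * L ν)) 0 (δs ν 4 - δs ν 1) with hΛ
    set E₀ := Real.exp (δs ν 1 * L ν) with hE₀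
    set e := Real.exp ((δs ν 4 - δs ν 1) * L ν) with he
    have hE₀pos : 0 < E₀ := Real.exp_pos _
    have hepos : 0 < e := Real.exp_pos _
    have h00le : |g00| ≤ μ ν := by have := hdom ν 1 1; simp only [f10, f14, f15, if_false, if_true] at this; exact this
    have hdom00 : E₀ * E₀ * |g00 + 2 * Λ * g05 + Λ * Λ * g55| ≤ μ' ν := by
      have := hdom' ν 1 1
      simp only [f10, f14, f15, if_false, if_true] at this
      rw [i00, abs_mul, abs_of_pos (mul_pos hE₀pos hE₀pos)] at this
      exact this
    have hdom05 : E₀ * E₀ * e * |g05 + Λ * g55| ≤ μ' ν := by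
      have := hdom' ν 1 4
      simp only [f40, f41, f45, f10, f14, f15, if_false, if_true] at this
      rw [i05, abs_mul, abs_of_pos (by positivity)] at this
      exact this
    have halive : κ' * μ' ν ≤ E₀ * E₀ * (e * e) * |g55| := by
      rw [i55, abs_mul, abs_of_pos (by positivity)] at hν2
      exact hν2
    have hΛge : 4 / κ ≤ |Λ| := by rw [zero_mul, zero_add] at hνb; exact hνb.le
    have hcore := triple_mid_core hκpos hκ'pos (hμ ν) hepos hE₀pos hν1 h00le hdom00 hdom05 halive hΛge
    rw [add_zero] at hνa
    exact absurd (lt_of_le_of_lt hcore hνa) (lt_irrefl _)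
  exact hfalse.exists.elim fun _ h => h

end Summit.ValiantsHypothesis.ValiantsHypothesis.Theorems.LacunarySymmetroidMatrixDescartes.WallBubbling
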